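import Summits.CriticalPhenomena.PercolationContinuityZ3.Theorems.PercNearOneGluingNoHeavyLowerTailSahiCTCLadderRowsA
import HarnessLib

/-!
# `NoHeavyLowerTail` (crux stmt-CriticalPhenomena-4575), P3 lane: the row with one doubled point of the ladder inequality, in Kleitman-surplus form
# (memo g25 §3 (v)) — induction on the number of single points

Support file (seat `prim-l12-p3`, gen 25; `--supports stmt-CriticalPhenomena-4575`).  For 2-live up-sets `𝒳, 𝒵`, a point `d` and a finset `T ∌ d`
(`t = #T`, `N = {y ∈ T : {d,y} common}`, `W(T)` = common 2-sets inside `T`):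
    `rhs := [t ≥ 3]·((t+1)·#N + #W(T)) + [t = 2]·#N  ≤  Σ_{y ∈ T} κ(∅, d ∪ T−y) + Σ_{E ∈ C(T,2)} κ({d}, T \ E) =: lhs`   (`rowOne_le`).
This file: the vertex recursion of `…KleitmanSurplus` peels one point `y₀ ∈ T` off every cube (`lhs_step`), and the DEGREE / LOOP / TRIANGLE lemmas
pay the difference of the right sides (`step_bound`).  The base cases and the induction are in `…SahiCTCLadderRowOne`.  Nothing is asserted about the crux.
-/

namespace Summit.CriticalPhenomena.PercolationContinuityZ3.Theorems.SahiCTCForms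

open Finset

variable {α : Type*} [DecidableEq α]

/-! ### Reindexing sums over `C(T,k)` by complements -/

/-- `Σ_{E ∈ C(T,k)} f(T \ E) = Σ_{F ∈ C(T, #T−k)} f(F)`. [folklore] -/
theorem sum_powersetCard_sdiff {β : Type*} [AddCommMonoid β] (T : Finset α) {k : ℕ} (hk : k ≤ #T) (f : Finset α → β) :
    ∑ E ∈ T.powersetCard k, f (T \ E) = ∑ F ∈ T.powersetCard (#T - k), f F := by
  refine sum_bij' (fun E _ => T \ E) (fun F _ => T \ F) (fun E hE => ?_) (fun F hF => ?_) (fun E hE => ?_) (fun F hF => ?_)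
    (fun E _ => rfl)
  · obtain ⟨hET, hEk⟩ := mem_powersetCard.1 hE
    exact mem_powersetCard.2 ⟨sdiff_subset, by rw [card_sdiff_of_subset hET, hEk]⟩
  · obtain ⟨hFT, hFk⟩ := mem_powersetCard.1 hF
    exact mem_powersetCard.2 ⟨sdiff_subset, by rw [card_sdiff_of_subset hFT, hFk]; omega⟩
  · exact Finset.sdiff_sdiff_eq_self (mem_powersetCard.1 hE).1
  · exact Finset.sdiff_sdiff_eq_self (mem_powersetCard.1 hF).1

omit [DecidableEq α] in
/-- `Σ_{F ∈ C(T,1)} f(F) = Σ_{y ∈ T} f {y}`. [folklore] -/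
theorem sum_powersetCard_one {β : Type*} [AddCommMonoid β] (T : Finset α) (f : Finset α → β) :
    ∑ F ∈ T.powersetCard 1, f F = ∑ y ∈ T, f {y} := by
  rw [powersetCard_one, sum_map]; rfl

section RowOne
variable {𝒳 𝒵 : Finset (Finset α)} {d : α}

/-! ### The step: peel `y₀ ∈ T` off every cube -/

/-- Left side of row (v). -/
theorem lhs_step (h𝒳 : IsUpperSet (𝒳 : Set (Finset α))) (h𝒵 : IsUpperSet (𝒵 : Set (Finset α))) {T : Finset α}
    (hdT : d ∉ T) {y₀ : α} (hy₀ : y₀ ∈ T) :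
    kap 𝒳 𝒵 ∅ (insert d (T.erase y₀))
      + (∑ y ∈ T.erase y₀, kap 𝒳 𝒵 ∅ (insert d ((T.erase y₀).erase y))
          + ∑ E ∈ (T.erase y₀).powersetCard 2, kap 𝒳 𝒵 {d} ((T.erase y₀) \ E))
      + ∑ y ∈ T.erase y₀, kap 𝒳 𝒵 {d} ((T.erase y₀).erase y)
      + ∑ y ∈ T.erase y₀, kap 𝒳 𝒵 {y₀} (insert d ((T.erase y₀).erase y))
      ≤ ∑ y ∈ T, kap 𝒳 𝒵 ∅ (insert d (T.erase y)) + ∑ E ∈ T.powersetCard 2, kap 𝒳 𝒵 {d} (T \ E) := by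
  set T' := T.erase y₀ with hT'
  have hdy₀ : d ≠ y₀ := fun h => hdT (h ▸ hy₀)
  have hy₀T' : y₀ ∉ T' := notMem_erase y₀ T
  -- (1) the restriction cubes
  have h1 : kap 𝒳 𝒵 ∅ (insert d T') + ∑ y ∈ T', (kap 𝒳 𝒵 ∅ (insert d (T'.erase y)) + kap 𝒳 𝒵 {y₀} (insert d (T'.erase y)))
      ≤ ∑ y ∈ T, kap 𝒳 𝒵 ∅ (insert d (T.erase y)) := by
    rw [← add_sum_erase T _ hy₀]
    refine add_le_add le_rfl (sum_le_sum fun y hy => ?_)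
    have hyy₀ : y ≠ y₀ := ne_of_mem_erase hy
    have hmem : y₀ ∈ insert d (T.erase y) := mem_insert_of_mem (mem_erase.2 ⟨hyy₀.symm, hy₀⟩)
    have hrec := kap_rec (𝒳 := 𝒳) (𝒵 := 𝒵) (D := ∅) h𝒳 h𝒵 hmem (notMem_empty y₀)
    have he : (insert d (T.erase y)).erase y₀ = insert d (T'.erase y) := by
      rw [erase_insert_of_ne hdy₀, hT', erase_right_comm]
    rw [he, insert_empty] at hrec
    rw [hrec]
    have : (0 : ℤ) ≤ #((tr 𝒳 {y₀} (insert d (T'.erase y)) \ tr 𝒳 ∅ (insert d (T'.erase y))).filter fun R =>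
        insert d (T'.erase y) \ R ∈ tr 𝒵 {y₀} (insert d (T'.erase y)) ∧
          insert d (T'.erase y) \ R ∉ tr 𝒵 ∅ (insert d (T'.erase y))) := Nat.cast_nonneg _
    linarith
  -- (2) the based cubes: split C(T,2) by `y₀ ∈ E`
  have hT : T = insert y₀ T' := (insert_erase hy₀).symm
  have h2 : ∑ E ∈ T'.powersetCard 2, kap 𝒳 𝒵 {d} (T' \ E) + ∑ y ∈ T', kap 𝒳 𝒵 {d} (T'.erase y)
      ≤ ∑ E ∈ T.powersetCard 2, kap 𝒳 𝒵 {d} (T \ E) := by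
    rw [hT, powersetCard_succ_insert hy₀T', sum_union, sum_image]
    · refine add_le_add (sum_le_sum fun E hE => ?_) (le_of_eq ?_)
      · -- E avoids y₀: delete y₀ from the free set
        obtain ⟨hET', _⟩ := mem_powersetCard.1 hE
        have hy₀E : y₀ ∉ E := fun h => hy₀T' (hET' h)
        have hmem : y₀ ∈ insert y₀ T' \ E := mem_sdiff.2 ⟨mem_insert_self _ _, hy₀E⟩
        have hdisj : Disjoint ({d} : Finset α) (insert y₀ T' \ E) := by
          rw [disjoint_singleton_left, ← hT]; exact fun h => hdT (mem_sdiff.1 h).1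
        have := kap_erase_le (𝒳 := 𝒳) (𝒵 := 𝒵) h𝒳 h𝒵 hdisj hmem
        have he : (insert y₀ T' \ E).erase y₀ = T' \ E := by
          rw [← hT, hT', ← sdiff_singleton_eq_erase, ← sdiff_singleton_eq_erase, sdiff_right_comm]
        rw [he] at this; exact this
      · rw [sum_powersetCard_one]
        refine sum_congr rfl fun y hy => ?_
        congr 1
        rw [← hT]
        ext x; simp only [mem_sdiff, mem_insert, mem_singleton, hT', mem_erase]; tauto
    · -- `insert y₀` is injective on subsets of T'
      intro F hF F' hF' h
      have h1 : y₀ ∉ F := fun hh => hy₀T' ((mem_powersetCard.1 (Finset.mem_coe.1 hF)).1 hh)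
      have h2 : y₀ ∉ F' := fun hh => hy₀T' ((mem_powersetCard.1 (Finset.mem_coe.1 hF')).1 hh)
      rw [← erase_insert h1, h, erase_insert h2]
    · rw [Finset.disjoint_left]; intro E hE hE'
      obtain ⟨F, hF, rfl⟩ := mem_image.1 hE'
      exact hy₀T' ((mem_powersetCard.1 hE).1 (mem_insert_self y₀ F))
  rw [sum_add_distrib] at h1
  linarith

end RowOne

section RowOneBound
variable {𝒳 𝒵 : Finset (Finset α)} {d : α}

/-- **The step bound** (memo g25 §3 (v), STEP): for `#T ≥ 4` there is `y₀ ∈ T` such that, with `T' = T − y₀`, `N = cnbrs(d)`, `W = cedges`,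
`(t+1)·#N(T) + #W(T) ≤ t·#N(T') + #W(T') + κ(∅, d∪T') + Σ_{y∈T'} κ({d}, T'−y) + Σ_{y∈T'} κ({y₀}, d∪T'−y)`. [this work] -/
theorem step_bound (h𝒳 : IsUpperSet (𝒳 : Set (Finset α))) (h𝒵 : IsUpperSet (𝒵 : Set (Finset α)))
    (hX2 : ∀ U ∈ 𝒳, 2 ≤ #U) (hZ2 : ∀ U ∈ 𝒵, 2 ≤ #U) {T : Finset α} (hdT : d ∉ T) (ht : 4 ≤ #T) :
    ∃ y₀ ∈ T, ((#T : ℤ) + 1) * #(cnbrs 𝒳 𝒵 (insert d T) d) + #(cedges 𝒳 𝒵 T) ≤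
      (#T : ℤ) * #(cnbrs 𝒳 𝒵 (insert d (T.erase y₀)) d) + #(cedges 𝒳 𝒵 (T.erase y₀))
        + kap 𝒳 𝒵 ∅ (insert d (T.erase y₀))
        + ∑ y ∈ T.erase y₀, kap 𝒳 𝒵 {d} ((T.erase y₀).erase y)
        + ∑ y ∈ T.erase y₀, kap 𝒳 𝒵 {y₀} (insert d ((T.erase y₀).erase y)) := by
  set N := cnbrs 𝒳 𝒵 (insert d T) d with hN
  have hNT : N ⊆ T := fun y hy => ((mem_cnbrs_insert hdT).1 hy).1
  have hdX : ({d} : Finset α) ∉ 𝒳 := fun h => by have := hX2 _ h; simp at this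
  have hdZ : ({d} : Finset α) ∉ 𝒵 := fun h => by have := hZ2 _ h; simp at this
  -- generic facts for any y₀ ∈ T
  have hgen : ∀ y₀ ∈ T,
      (0 ≤ kap 𝒳 𝒵 ∅ (insert d (T.erase y₀))) ∧
      (∀ y ∈ T.erase y₀, 0 ≤ kap 𝒳 𝒵 {d} ((T.erase y₀).erase y)) ∧
      (∀ y ∈ T.erase y₀, 0 ≤ kap 𝒳 𝒵 {y₀} (insert d ((T.erase y₀).erase y))) ∧
      (∀ y ∈ T.erase y₀, (∃ u ∈ (T.erase y₀).erase y, ({d, u} : Finset α) ∈ 𝒳 ∧ ({d, u} : Finset α) ∈ 𝒵) →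
          1 ≤ kap 𝒳 𝒵 {d} ((T.erase y₀).erase y)) ∧
      (∀ y ∈ T.erase y₀, (∃ u ∈ insert d ((T.erase y₀).erase y), ({y₀, u} : Finset α) ∈ 𝒳 ∧ ({y₀, u} : Finset α) ∈ 𝒵) →
          1 ≤ kap 𝒳 𝒵 {y₀} (insert d ((T.erase y₀).erase y))) ∧
      ((N.erase y₀).Nonempty → (#(N.erase y₀) : ℤ) + 1 ≤ kap 𝒳 𝒵 ∅ (insert d (T.erase y₀))) := by
    intro y₀ hy₀
    have hdy₀ : d ≠ y₀ := fun h => hdT (h ▸ hy₀)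
    have hy₀X : ({y₀} : Finset α) ∉ 𝒳 := fun h => by have := hX2 _ h; simp at this
    have hy₀Z : ({y₀} : Finset α) ∉ 𝒵 := fun h => by have := hZ2 _ h; simp at this
    refine ⟨kap_nonneg h𝒳 h𝒵 _ _ (disjoint_empty_left _), fun y hy => kap_nonneg h𝒳 h𝒵 _ _ ?_,
      fun y hy => kap_nonneg h𝒳 h𝒵 _ _ ?_, fun y hy ⟨u, hu, hX, hZ⟩ => ?_, fun y hy ⟨u, hu, hX, hZ⟩ => ?_, fun hne => ?_⟩
    · rw [disjoint_singleton_left]; exact fun h => hdT (mem_of_mem_erase (mem_of_mem_erase h))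
    · rw [disjoint_singleton_left, mem_insert, not_or]
      exact ⟨hdy₀.symm, fun h => notMem_erase y₀ T (mem_of_mem_erase h)⟩
    · rw [pair_comm] at hX hZ; exact one_le_kap_of_loop h𝒳 h𝒵 hdX hdZ hu hX hZ
    · rw [pair_comm] at hX hZ; exact one_le_kap_of_loop h𝒳 h𝒵 hy₀X hy₀Z hu hX hZ
    · have hdT' : d ∉ T.erase y₀ := fun h => hdT (mem_of_mem_erase h)
      have h := card_cnbrs_add_one_le_kap h𝒳 h𝒵 hX2 hZ2 _ (insert d (T.erase y₀)) d rfl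
        (by rw [card_insert_of_notMem hdT', card_erase_of_mem hy₀]; omega) (mem_insert_self _ _)
        (by rw [cnbrs_insert_erase hdT y₀]; exact hne)
      rw [cnbrs_insert_erase hdT y₀] at h; exact h
  by_cases hA : ∃ y₀ ∈ T, y₀ ∉ N
  · -- Case A: a point of T that is not a common neighbour of d
    obtain ⟨y₀, hy₀, hy₀N⟩ := hA
    obtain ⟨h0a, h0b, h0c, h1b, h1c, hdeg⟩ := hgen y₀ hy₀
    have hdy₀ : d ≠ y₀ := fun h => hdT (h ▸ hy₀)
    refine ⟨y₀, hy₀, ?_⟩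
    rw [cnbrs_insert_erase hdT y₀, ← hN, erase_eq_of_notMem hy₀N]
    have hW := card_cedges_eq_erase_add (𝒳 := 𝒳) (𝒵 := 𝒵) hy₀
    have hdegle : #(cnbrs 𝒳 𝒵 T y₀) ≤ #T - 1 := by
      have := card_le_card (filter_subset _ (T.erase y₀) : cnbrs 𝒳 𝒵 T y₀ ⊆ T.erase y₀)
      rw [card_erase_of_mem hy₀] at this; exact this
    have hT' : #(T.erase y₀) = #T - 1 := card_erase_of_mem hy₀
    -- sums of the based cubes
    have hsum2 : ∀ X : Finset α, (∀ y ∈ T.erase y₀, y ∉ X → ∃ u ∈ (T.erase y₀).erase y, ({d, u} : Finset α) ∈ 𝒳 ∧ ({d, u} : Finset α) ∈ 𝒵) →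
        (#(T.erase y₀) : ℤ) - #X ≤ ∑ y ∈ T.erase y₀, kap 𝒳 𝒵 {d} ((T.erase y₀).erase y) := fun X hX =>
      card_sub_le_sum h0b fun y hy hyX => h1b y hy (hX y hy hyX)
    have hsum3 : ∀ X : Finset α, (∀ y ∈ T.erase y₀, y ∉ X →
          ∃ u ∈ insert d ((T.erase y₀).erase y), ({y₀, u} : Finset α) ∈ 𝒳 ∧ ({y₀, u} : Finset α) ∈ 𝒵) →
        (#(T.erase y₀) : ℤ) - #X ≤ ∑ y ∈ T.erase y₀, kap 𝒳 𝒵 {y₀} (insert d ((T.erase y₀).erase y)) := fun X hX =>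
      card_sub_le_sum h0c fun y hy hyX => h1c y hy (hX y hy hyX)
    have hs2nn : 0 ≤ ∑ y ∈ T.erase y₀, kap 𝒳 𝒵 {d} ((T.erase y₀).erase y) := sum_nonneg h0b
    have hs3nn : 0 ≤ ∑ y ∈ T.erase y₀, kap 𝒳 𝒵 {y₀} (insert d ((T.erase y₀).erase y)) := sum_nonneg h0c
    have hW' : (#(cedges 𝒳 𝒵 T) : ℤ) = #(cedges 𝒳 𝒵 (T.erase y₀)) + #(cnbrs 𝒳 𝒵 T y₀) := by exact_mod_cast hW
    have hdegle' : (#(cnbrs 𝒳 𝒵 T y₀) : ℤ) ≤ #T - 1 := by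
      have h1 : 1 ≤ #T := by omega
      have := (Nat.cast_le (α := ℤ)).2 hdegle; push_cast [Nat.cast_sub h1] at this; exact this
    have hT'' : (#(T.erase y₀) : ℤ) = #T - 1 := by
      have h1 : 1 ≤ #T := by omega
      rw [hT']; push_cast [Nat.cast_sub h1]; ring
    -- three sub-cases on #N
    rcases Nat.lt_or_ge (#N) 2 with hN2 | hN2
    · rcases Nat.lt_or_ge (#N) 1 with hN1 | hN1
      · -- #N = 0: the link cubes of y₀ pay the edges at y₀
        have hN0 : #N = 0 := by omega
        rcases Nat.lt_or_ge (#(cnbrs 𝒳 𝒵 T y₀)) 2 with hc2 | hc2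
        · by_cases hc0 : cnbrs 𝒳 𝒵 T y₀ = ∅
          · have : (#(cnbrs 𝒳 𝒵 T y₀) : ℤ) = 0 := by rw [hc0, card_empty, Nat.cast_zero]
            rw [hN0]; push_cast; nlinarith
          · obtain ⟨u₀, hu₀⟩ := nonempty_iff_ne_empty.2 hc0
            have h3 := hsum3 (cnbrs 𝒳 𝒵 T y₀) fun y hy hyX => ?_
            · have hc1 : #(cnbrs 𝒳 𝒵 T y₀) = 1 := by have := card_pos.2 ⟨u₀, hu₀⟩; omega
              have : (#(cnbrs 𝒳 𝒵 T y₀) : ℤ) = 1 := by exact_mod_cast hc1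
              rw [hN0]; push_cast; nlinarith
            · obtain ⟨⟨huT, huy₀⟩, hX, hZ⟩ := mem_cnbrs.1 hu₀
              have huy : u₀ ≠ y := fun h => hyX (h ▸ hu₀)
              exact ⟨u₀, mem_insert_of_mem (mem_erase.2 ⟨huy, mem_erase.2 ⟨huy₀, huT⟩⟩), hX, hZ⟩
        · -- ≥ 2 edges at y₀: every y gets a loop
          have h3 := hsum3 ∅ fun y hy _ => ?_
          · rw [card_empty, Nat.cast_zero, sub_zero] at h3
            rw [hN0]; push_cast; nlinarith
          · obtain ⟨u, u', hu, hu', huu'⟩ := one_lt_card_iff.1 hc2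
            obtain ⟨⟨huT, huy₀⟩, hX, hZ⟩ := mem_cnbrs.1 hu
            obtain ⟨⟨hu'T, hu'y₀⟩, hX', hZ'⟩ := mem_cnbrs.1 hu'
            by_cases huy : u = y
            · refine ⟨u', mem_insert_of_mem (mem_erase.2 ⟨fun h => huu' (huy.trans h.symm), mem_erase.2 ⟨hu'y₀, hu'T⟩⟩), hX', hZ'⟩
            · exact ⟨u, mem_insert_of_mem (mem_erase.2 ⟨huy, mem_erase.2 ⟨huy₀, huT⟩⟩), hX, hZ⟩
      · -- #N = 1
        have hN1' : #N = 1 := by omega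
        obtain ⟨n, hn⟩ := card_eq_one.1 hN1'
        have hnT : n ∈ T := hNT (by rw [hn]; exact mem_singleton_self n)
        have hny₀ : n ≠ y₀ := fun h => hy₀N (by rw [hn, h]; exact mem_singleton_self _)
        have hdegN : (1 : ℤ) + 1 ≤ kap 𝒳 𝒵 ∅ (insert d (T.erase y₀)) := by
          have := hdeg (by rw [erase_eq_of_notMem hy₀N, hn]; exact singleton_nonempty n)
          rw [erase_eq_of_notMem hy₀N, hn, card_singleton] at this; exact_mod_cast this
        have h2 := hsum2 {n} fun y hy hyn => ?_
        · rw [card_singleton] at h2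
          rw [hn, card_singleton]; push_cast at h2 ⊢; nlinarith
        · obtain ⟨_, hX, hZ⟩ := (mem_cnbrs_insert hdT).1 (show n ∈ N by rw [hn]; exact mem_singleton_self n)
          refine ⟨n, mem_erase.2 ⟨fun h => hyn (by rw [h]; exact mem_singleton_self _), mem_erase.2 ⟨hny₀, hnT⟩⟩, hX, hZ⟩
    · -- #N ≥ 2
      have hdegN : (#N : ℤ) + 1 ≤ kap 𝒳 𝒵 ∅ (insert d (T.erase y₀)) := by
        have := hdeg (by rw [erase_eq_of_notMem hy₀N]; exact card_pos.1 (by omega))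
        rw [erase_eq_of_notMem hy₀N] at this; exact this
      have h2 := hsum2 ∅ fun y hy _ => ?_
      · rw [card_empty, Nat.cast_zero, sub_zero] at h2
        nlinarith
      · obtain ⟨u, u', hu, hu', huu'⟩ := one_lt_card_iff.1 hN2
        obtain ⟨huT, hX, hZ⟩ := (mem_cnbrs_insert hdT).1 hu
        obtain ⟨hu'T, hX', hZ'⟩ := (mem_cnbrs_insert hdT).1 hu'
        have huy₀ : u ≠ y₀ := fun h => hy₀N (h ▸ hu)
        have hu'y₀ : u' ≠ y₀ := fun h => hy₀N (h ▸ hu')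
        by_cases huy : u = y
        · exact ⟨u', mem_erase.2 ⟨fun h => huu' (huy.trans h.symm), mem_erase.2 ⟨hu'y₀, hu'T⟩⟩, hX', hZ'⟩
        · exact ⟨u, mem_erase.2 ⟨huy, mem_erase.2 ⟨huy₀, huT⟩⟩, hX, hZ⟩
  · -- Case B: every point of T is a common neighbour of d
    push Not at hA
    have hNeq : N = T := Subset.antisymm hNT fun y hy => hA y hy
    have hTne : T.Nonempty := card_pos.1 (by omega)
    obtain ⟨y₀, hy₀, hmin⟩ := exists_min_image T (fun y => #(cnbrs 𝒳 𝒵 T y)) hTne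
    obtain ⟨h0a, h0b, h0c, h1b, h1c, hdeg⟩ := hgen y₀ hy₀
    have hdy₀ : d ≠ y₀ := fun h => hdT (h ▸ hy₀)
    refine ⟨y₀, hy₀, ?_⟩
    rw [cnbrs_insert_erase hdT y₀, ← hN, hNeq]
    have hW := card_cedges_eq_erase_add (𝒳 := 𝒳) (𝒵 := 𝒵) hy₀
    have hW' : (#(cedges 𝒳 𝒵 T) : ℤ) = #(cedges 𝒳 𝒵 (T.erase y₀)) + #(cnbrs 𝒳 𝒵 T y₀) := by exact_mod_cast hW
    have hT' : #(T.erase y₀) = #T - 1 := card_erase_of_mem hy₀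
    have h1 : 1 ≤ #T := by omega
    have hT'' : (#(T.erase y₀) : ℤ) = #T - 1 := by rw [hT']; push_cast [Nat.cast_sub h1]; ring
    have hdegle : #(cnbrs 𝒳 𝒵 T y₀) ≤ #T - 1 := by
      have := card_le_card (filter_subset _ (T.erase y₀) : cnbrs 𝒳 𝒵 T y₀ ⊆ T.erase y₀)
      rw [card_erase_of_mem hy₀] at this; exact this
    -- T2 ≥ t − 1 and T3 ≥ t − 1
    have h2 : (#(T.erase y₀) : ℤ) - #(∅ : Finset α) ≤ ∑ y ∈ T.erase y₀, kap 𝒳 𝒵 {d} ((T.erase y₀).erase y) :=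
      card_sub_le_sum h0b fun y hy _ => h1b y hy (by
        have : 2 ≤ #((T.erase y₀).erase y) := by rw [card_erase_of_mem hy, hT']; omega
        obtain ⟨u, -, hu, -, -⟩ := one_lt_card_iff.1 (by omega : 1 < #((T.erase y₀).erase y))
        obtain ⟨_, hX, hZ⟩ := (mem_cnbrs_insert hdT).1 (hNeq ▸ mem_of_mem_erase (mem_of_mem_erase hu) : u ∈ N)
        exact ⟨u, hu, hX, hZ⟩)
    have h3 : (#(T.erase y₀) : ℤ) - #(∅ : Finset α) ≤ ∑ y ∈ T.erase y₀, kap 𝒳 𝒵 {y₀} (insert d ((T.erase y₀).erase y)) :=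
      card_sub_le_sum h0c fun y hy _ => h1c y hy (by
        obtain ⟨_, hX, hZ⟩ := (mem_cnbrs_insert hdT).1 (hNeq ▸ hy₀ : y₀ ∈ N)
        exact ⟨d, mem_insert_self _ _, by rw [pair_comm]; exact hX, by rw [pair_comm]; exact hZ⟩)
    rw [card_empty, Nat.cast_zero, sub_zero] at h2 h3
    -- T1 ≥ t, and ≥ t + 1 if the minimum degree is t − 1
    have hT1 : (#(T.erase y₀) : ℤ) + 1 ≤ kap 𝒳 𝒵 ∅ (insert d (T.erase y₀)) := by
      have := hdeg (by rw [hNeq]; exact card_pos.1 (by rw [hT']; omega))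
      rw [hNeq] at this; exact this
    rcases Nat.lt_or_ge (#(cnbrs 𝒳 𝒵 T y₀)) (#T - 1) with hlt | hge
    · have : (#(cnbrs 𝒳 𝒵 T y₀) : ℤ) ≤ #T - 2 := by
        have h2' : 2 ≤ #T := by omega
        have := (Nat.cast_le (α := ℤ)).2 (by omega : #(cnbrs 𝒳 𝒵 T y₀) ≤ #T - 2)
        push_cast [Nat.cast_sub h2'] at this; exact this
      nlinarith
    · -- the common-edge graph is complete on d ∪ T: triangle ⇒ T1 ≥ t + 1
      have hfull : ∀ y ∈ T, cnbrs 𝒳 𝒵 T y = T.erase y := fun y hy =>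
        eq_of_subset_of_card_le (filter_subset _ _) (by
          rw [card_erase_of_mem hy]; exact hge.trans (hmin y hy))
      have hT'3 : 3 ≤ #(T.erase y₀) := by rw [hT']; omega
      obtain ⟨y₁, y₂, hy₁, hy₂, h12⟩ := one_lt_card_iff.1 (by omega : 1 < #(T.erase y₀))
      have hy₁T : y₁ ∈ T := mem_of_mem_erase hy₁
      have hy₂T : y₂ ∈ T := mem_of_mem_erase hy₂
      obtain ⟨_, hX1, hZ1⟩ := (mem_cnbrs_insert hdT).1 (hNeq ▸ hy₁T : y₁ ∈ N)
      obtain ⟨_, hX2', hZ2'⟩ := (mem_cnbrs_insert hdT).1 (hNeq ▸ hy₂T : y₂ ∈ N)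
      have h12mem : y₂ ∈ cnbrs 𝒳 𝒵 T y₁ := by rw [hfull y₁ hy₁T]; exact mem_erase.2 ⟨h12.symm, hy₂T⟩
      obtain ⟨_, hX12, hZ12⟩ := mem_cnbrs.1 h12mem
      have hdT' : d ∉ T.erase y₀ := fun h => hdT (mem_of_mem_erase h)
      have hd1 : d ≠ y₁ := fun h => hdT (h ▸ hy₁T)
      have hd2 : d ≠ y₂ := fun h => hdT (h ▸ hy₂T)
      have htri := card_add_one_le_kap_of_triangle h𝒳 h𝒵 hX2 hZ2 (s := insert d (T.erase y₀)) (mem_insert_self _ _)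
        (mem_insert_of_mem hy₁) (mem_insert_of_mem hy₂) (mem_inter.2 ⟨hX1, hZ1⟩) (mem_inter.2 ⟨hX12, hZ12⟩)
        (mem_inter.2 ⟨hX2', hZ2'⟩) hd1 h12 hd2
      rw [card_insert_of_notMem hdT'] at htri
      push_cast at htri
      have : (#(cnbrs 𝒳 𝒵 T y₀) : ℤ) ≤ #T - 1 := by
        have := (Nat.cast_le (α := ℤ)).2 hdegle; push_cast [Nat.cast_sub h1] at this; exact this
      nlinarith

end RowOneBound

end Summit.CriticalPhenomena.PercolationContinuityZ3.Theorems.SahiCTCForms
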